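import Summits.HodgeConjecture.HodgeConjecture.Theses.MilnorKExponential

/-!
# Route MilnorKExponential — `Assembly` (assembly item stmt-HodgeConjecture-18737)

The assembly item of route `MilnorKExponential`:

  HodgeModelsExist → SymbolClassesAlgebraic → SymbolLiftR → HodgeConjecture,

is the route's deciding theorem `MilnorKExponential.closes` curried (Hodge models give the
anti-vacuity conjunct of `HodgeConjectureFor`; codimension `0` by `hodgeConjectureFor_codim_zero`;
`p = q + 1 ≤ n` by `SymbolLiftR` then `SymbolClassesAlgebraic`; `p > n` because a `(p, p)`-class in
`H²ᵖ = 0` vanishes).  Pure logic over the route file; no other import, no named-fact hypothesis, no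
sorry.
-/

-- `Summit.HodgeConjecture.HodgeConjecture.Theorems` is the mandated namespace (single-problem
-- summit: Problem = Summit), which `linter.dupNamespace` flags on every declaration; the lakefile
-- turns the linter off tree-wide (weak option), restated here so stand-alone elaboration is
-- warning-free too.
set_option linter.dupNamespace false

namespace Summit.HodgeConjecture.HodgeConjecture.Theorems

/-- **Item stmt-HodgeConjecture-18737 (`Assembly`), route `MilnorKExponential`**: Hodge models,
"symbol classes are algebraic" and the repaired symbol lift `SymbolLiftR` imply the Hodge
conjecture — literally the route's deciding theorem `MilnorKExponential.closes`, curried.  The type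
is the route decl `Summit.HodgeConjecture.HodgeConjecture.Theses.MilnorKExponential.Assembly`.
[cite: Deligne2000, §1] -/
theorem milnorKExponential_assembly_proof :
    Summit.HodgeConjecture.HodgeConjecture.Theses.MilnorKExponential.Assembly :=
  fun hM hGK hLift ↦ Summit.HodgeConjecture.HodgeConjecture.Theses.MilnorKExponential.closes hM hGK hLift

end Summit.HodgeConjecture.HodgeConjecture.Theorems
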